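import Mathlib
import HarnessLib
import HarnessLib.Audit
import Summits.CriticalPhenomena.Statement
import HarnessLib.Audit.Status.Attr

/-!
Route: PersistenceSpeed

# Route PersistenceSpeed — a + boundary that cannot out-shout bulk noise makes the 3D Ising limit
non-Gaussian, by persistence speed

It suffices to show X = (BBS) ∧ (T) ∧ (ML). (BBS) BOUNDED BOUNDARY SIGNAL at one aspect ratio on ℤ³
at β_c: for some K ≥ 2 and A,
Σ_{x∈Λ_L} ⟨σ_x⟩⁺_{Λ_{KL}} ≤ A · (Σ_{x,y∈Λ_L} ⟨σ_xσ_y⟩_{β_c})^{1/2} for all L — the + boundary at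
distance (K−1)L magnetises the
inner block S_{Λ_L} by at most A bulk standard deviations (implied by one-arm hyperscaling —
kernel-checked composition of its birth skeleton; false
in d ≥ 5). (T) the TRANSFER THEOREM U4OfBoundarySignal (the new lever): BBS forbids every
translation-invariant, scale-covariant,
non-degenerate pointwise scaling limit of the critical correlators from being Gaussian, because a
Gaussian critical limit lets all M³
mesoscopic blocks of a grid exceed a·sd simultaneously at CAPACITY cost exp(−O(M^{2Δ+o(1)})), 2Δ ≤ 2
< 3, while BBS + GHS + DLR–Markov
+ FKG charge VOLUME cost 2^{−M³}. (ML) = shared item stmt-CriticalPhenomena-1344 (the conjunct minus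
clause (iii)). Realises card
boundary-cannot-dictate-persistence with the threshold shifted from 0 to a·sd_L, which replaces its
RSW₃ input by BBS.
Lean: `BoundedBoundarySignal ∧ U4OfBoundarySignal ∧ MoebiusLimit`

## Assembly
Pure logic (sorry-free in Sketch.lean): take (ρ, Δ, S) from MoebiusLimit; Möbius covariance contains
translation invariance and scale
covariance (IsMoebiusCovariant.isEuclideanInvariant.1, .isScaleCovariant); U4OfBoundarySignal
applied to BoundedBoundarySignal gives
HasNontrivialU4 S; the tuple is Ising3DConformalLimit. The deciding theorem `closes` consumes the
Assembly item together with the three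
cruxes (`closes hA hBBS hU4 hML := hA hBBS hU4 hML`), and `assembly_proof : Assembly` is proved in
Sketch.lean (to be landed at once).

Rationale: WHY THIS LINE. The large-deviation SPEED of shifted block persistence is an order parameter for
interaction: for any centred Gaussian limit X of the
normalised block field with Corr(X_z,X_w) ≳ |z−w|^{−2Δ} and 2Δ < 3 (on ℤ³, Δ ∈ [1/2,1] by
criticalTwoPoint_bounds), Slepian's lemma
against a generalized-Cauchy minorant with white-noise top-up and a Cameron–Martin shift by the
nonnegative equilibrium potential give
P[X_z > a ∀z ∈ [M]³] ≥ exp(−C M^{2Δ} log M) (the soft-mode computation Dorlas–van Enter /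
VanenterFernandezSokal1993 Thm 4.9 used to
declare the d > 4 majority-rule image non-Gibbsian, doi:10.1007/bf01042596), whereas for the n.n.
critical Gibbs state DLR–Markov
factorisation over corridor-separated cells and FKG maximality of the + boundary condition give
μ[all blocks > a·sd_L] ≤ (sup-cell
probability)^{M³}; BBS with GHS (GriffithsHurstSherman1970: Var⁺ ≤ Var_bulk and a sub-Gaussian UPPER
tail of the + state) makes the
cell probability ≤ e^{−2} once a = A + 2, and Newman1975 (Lee–Yang) + the Lebowitz1974/GKS pairing
bound + Potter bounds from scale
covariance identify the Gaussian. Imported areas: Gaussian extreme-value/persistence theory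
(Slepian, Cameron–Martin, Riesz capacity),
non-Gibbsian RG pathology theory read backwards, FK/one-arm percolation estimates. What no listed
route does: derive clause (iii) from a
ONE-SIDED boundary-influence bound with no exponent input (AnomalousForcesInteraction needs η > 0,
GammaForcesInteraction γ > 1,
CoerciveSharpness η < 1/2, SubPtolemyInterlacing a Δ-ceiling,
ArmHyperscaling/EnergyNotSigmaSquared/FKParityRobustness a current
MERGING floor that is (iii) in lattice dress); here the input is weaker than ArmHyperscaling's
one-arm crux stmt-15591 and is the same
estimate that route uses for ISOTROPY, so one percolation number now decides two clauses.

RANKED CRUXES. #2 BoundedBoundarySignal (crux) — BOUNDED BOUNDARY SIGNAL: ∃ K ≥ 2, A such that for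
all L ≥ 1, Σ_{x∈Λ_L} ⟨σ_x⟩⁺_{Λ_{KL};β_c(3),0} ≤ A·(Σ_{x,y∈Λ_L} ⟨σ₀σ_{x−y}⟩⁺_{β_c})^{1/2} — the
expected inner block spin under the + boundary condition at aspect ratio K is at most A bulk
standard deviations (E⁺_{Λ_{KL}}[S_{Λ_L}] ≤ A·sd_L). Implied by one-arm hyperscaling (stmt-15591)
through GKS volume antitonicity and the Messager–Miracle-Solé box comparison (birth skeleton
`Lines/birth.lean`, composition proved). [difficulty: open-problem] (why it might fail: It is
boundary SCREENING at the hyperscaling rate (one-arm exponent = Δσ up to the averaging): no bound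
m⁺_R ≤ R^{-c} is known in any d ≥ 3 (arXiv:2406.15243 §1.4.1, HandaHeydenreichSakai2019); FALSE for
d ≥ 5 (m⁺_R ≳ R^{-1} ≫ R^{-3/2}); a log excess of the + profile on ℤ³ breaks it.) [Tasaki1987,
HandaHeydenreichSakai2019, arXiv:2406.15243, DuminilcopinManolescu2022,
AizenmanDuminilCopinSidoravicius2015, FriedliVelenik2017]
#3 U4OfBoundarySignal (crux) — TRANSFER (the lever): BoundedBoundarySignal → every pointwise scaling
limit S of criticalCorr 3 (ρ > 0 on (0,1]) that is non-degenerate, translation invariant and scale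
covariant with some Δ has U₄ ≢ 0. Proof plan (registered birth skeleton, 3 stubs): threshold
non-dictation P⁺_{Λ_{KL}}[S_{Λ_L} ≤ (A+2)·sd_L] ≥ 1/2 (GHS); volume-order persistence ≤ 2^{−M³}
(DLR–Markov + FKG); Gaussian capacity-order persistence ≥ exp(−C M²√M) if U₄ ≡ 0 (Potter + pairing
bound + Newman Lee–Yang CLT + Slepian + Cameron–Martin, Δ ≤ 1); the composition is kernel-checked.
[deps: BoundedBoundarySignal] [difficulty: L] (why it might fail: Only via the
Gaussian-identification step: U₄ ≡ 0 off the diagonal must force the JOINT block law Gaussian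
(Potter uniformity near diagonals from scale covariance + Lee–Yang/orthant analyticity); a
non-Gaussian block law with vanishing off-diagonal U₄ would break capacity order.) [Newman1975,
Lebowitz1974, GriffithsHurstSherman1970, VanenterFernandezSokal1993, doi:10.1007/bf01042596,
CamiaGarbanNewman2016, GeorgiiGibbsMeasures2011]
#4 MoebiusLimit (crux) — shared item stmt-CriticalPhenomena-1344 (verbatim; the imported
complement): the critical correlators on ℤ³ have a non-degenerate pointwise scaling limit (ρ > 0 on
(0,1], Δ > 0, S) that is Möbius covariant with dimension Δ — the conjunct minus clause (iii). Not
attacked here; staffed through ExistsScaleCovariantLimit (stmt-1981), LimitRotationInvariant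
(stmt-1980; IsotropyFromOneArm stmt-15593 and RotationUpgradeFromTwoPoint stmt-8367 are PROVED) and
InversionUpgradeNormalised (stmt-1982), composed in the birth skeleton. [difficulty: open-problem]
(why it might fail: Existence of the full limit, O(3) invariance of the two-point kernel and
inversion covariance are each open on ℤ³ (ICM2022 §8.4); scale ⇏ conformal in general
(ScaleCovarianceNotMoebius) and the Ising exclusion of a Δ=2 virial current is non-rigorous.)
[DuminilCopinICM2022, PolandRychkovVichi2019, ElshowkNakayamaRychkov2011,
Literature.Barriers.CriticalPhenomena.ScaleCovarianceNotMoebius]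

TWO-LAYER PLAN. U4OfBoundarySignal ⇐ ThresholdNonDictation → VolumeOrderPersistence →
GaussianCapacityPersistence → U4OfBoundarySignal (the three
registered stubs, composition proved); BoundedBoundarySignal ⇐ OneArmHyperscaling (stmt-15591) →
PlusSumLe → BoxSumGe → BBS
(composition proved); MoebiusLimit ⇐ stmt-1981 → stmt-1980 → stmt-1982 (composition proved). Nothing
filed as items now.

KILL CRITERIA. A proof that the + boundary dictates at every ratio — Σ_{x∈Λ_L}⟨σ_x⟩⁺_{Λ_{KL}} / sd_L
→ ∞ for every K (e.g. from m⁺_R ≥ c R^{-Δ+κ}) —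
refutes BoundedBoundarySignal: close `refuted:BoundedBoundarySignal` (it would also refute
ArmHyperscaling's stmt-15591 and every
boundary-forgetting crux). A non-Gaussian block law with U₄ ≡ 0 off the diagonal compatible with
Lee–Yang refutes the transfer as
typed: pivot to the joint-law hypothesis (restate U4OfBoundarySignal with ¬Gaussian block limit as
conclusion, clause (iii) via Newman).
MergingFloor (stmt-15592) or GaussianLimitIsFree + EtaPositive proved elsewhere moot the transfer
but not BBS; ML refuted (e.g. a
log-periodic two-point law) kills every (iii)-sector route including this one.

NOT DECOMPOSED YET. The Gaussian lemmas (Slepian for finite Gaussian vectors, the Cameron–Martin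
shift inequality γ(F+h) ≥ γ(F)·exp(−‖h‖²/2 − ‖h‖/γ(F)),
the Riesz-type capacity bound Cap_k([M]³) ≤ 1/min k ≤ C M^{2Δ}), the Potter bounds of the axis
two-point function from scale
covariance, the joint Lee–Yang CLT on the positive orthant, and the DLR product lemma for
corridor-separated cells are layer-2 children
(stubs of the registered skeleton), attached by provers with --supports; the 2D rung (RSW ⇒ BBS ⇒
planar non-Gaussianity) is a
corollary, not an item.

CHEAPEST FALSIFIER. Monte-Carlo of the dimensionless ratio r(L;K) := E⁺_{Λ_{KL}}[S_{Λ_L}]/sd_L at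
β_c(3) = 0.2216546, K = 2,3, L = 4…48 (Swendsen–Wang with
frozen + boundary; the card's jobs j007294/j007295 measure the sign-event sibling P⁺[S_L ≤ 0]): r
drifting upward like a power of L
retires BoundedBoundarySignal (and ArmHyperscaling's OA); hyperscaling predicts r(L;K) → r*(K) ≍
K^{-Δ}. In-Lean falsifier already run:
the BC2/BC7 probes (no crux gives the conjunct; 3/3 CLEAN) and the d ≥ 5 consistency check on paper
(the chain proves ¬BBS there, as
it must by Aizenman–Fröhlich triviality and HandaHeydenreichSakai2019).

NUMBERS. Δσ(3) ≈ 0.5181 (PolandRychkovVichi2019) so capacity order M^{1.04} vs volume M³; rigorous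
window Δ ∈ [1/2, 1] (c|x|⁻² ≤ ⟨σ₀σ_x⟩ ≤
C|x|⁻¹, criticalTwoPoint_bounds), enough for 2Δ ≤ 2 < 5/2 < 3 as used by the skeleton; one-arm:
Tasaki's inequality m⁺_{|x|/3} ≥
√⟨σ₀σ_x⟩ (converse direction, known), saturation = BBS/OA (open); d = 2 control: m⁺_R ≍ R^{-1/8},
⟨σ₀σ_R⟩ ≍ R^{-1/4}
(DuminilcopinManolescu2022, CamiaGarbanNewman2016). Items at open: 4 (3 cruxes + assembly).

DEFINITION REQUESTS. None: box, isingCorr, BoundaryCondition.plus, criticalTwoPoint, criticalCorr,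
plusExpect, HasPointwiseScalingLimit, IsScaleCovariant,
HasNontrivialU4 exist; the skeleton's blockSd / blockSum / cellShift / persistAll / persistProb are
one-line local definitions.

Novelty: Searches (2026-08-17): all 53 open route theses of the sub read (levers in NOTES.md) +
closed_tonight; `ledger idea list --sub
Ising3DConformalLimit --status all` (131 cards; the 29 open read by title/mechanism,
boundary-cannot-dictate-persistence,
flat-isotherm-subquadratic-mgf, fk-giant-cluster-lindeberg, gaussian-instability-recursion read in
full); `ledger negatives --problem
CriticalPhenomena` (11, none on Ising₃); `lit search --hybrid` ×4 ("persistence probability Gaussian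
field capacity order sign of block
spin Ising non-Gaussian", "one-arm probability FK Ising boundary magnetization hyperscaling",
"entropic repulsion persistence long-range
Gaussian field capacity", "Ising block spin Gaussian limit fourth cumulant Lee-Yang Newman Slepian":
textbooks only — Friedli–Velenik,
Grimmett, Ellis); `lit search --source arxiv|zbmath` ×6 (hits: arXiv:1307.3926 CGN planar
non-Gaussianity; de Coninck CMP 109 (1987)
bivariate limit theorems; nothing on boundary-signal ⇒ non-Gaussian); `lit galaxy search --star
all|pdf` ×7 ("entropic repulsion",
"one-arm exponent" → Dewan–Muirhead arXiv:2102.12123 one-arm bounds for Gaussian-field percolation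
(the Gaussian class, opposite
side), DC–Li–Manolescu isoradial universality; "Tasaki", longer phrases 0 hits); read
arXiv:2406.15243 (Thm 2.4: current mixing in
d = 3 is qualitative ∀n∃N — the scale-invariant version is exactly the open content of BBS) and
arXiv:1511.05524 (Lupu–Werner; Ising =
GFF sign conditioned on h² ≡ 1, no shortcut). Open  [refs: 10.1007/bf01042596, 1307.3926, 2102.12123, 2406.15243, 1511.05524, doi:10.1007/bf01042596, VanenterFernandezSokal1993, CamiaGarbanNewman2016]

Barriers (technique_class: persistence-ld-speed, capacity-vs-volume, markov-fkg): - technique_class: persistence-ld-speed, capacity-vs-volume, markov-fkg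
- Literature.Barriers.CriticalPhenomena.IsingTrivialityFromDimensionFour: evaded provably — the
transfer is valid in every d ≥ 2 and, composed with Aizenman–Fröhlich triviality, OUTPUTS ¬BBS for d
≥ 5 (the + boundary dictates there, m⁺_R ≳ R^{2−d}·R ≫ R^{-(d-2)/2}); the only dimension-specific
input is BBS, false above d_c exactly as the barrier demands.
- Literature.Barriers.CriticalPhenomena.LongRangeTrivialityOnZ3: evaded — the volume-order half uses
the nearest-neighbour DLR–Markov factorisation across width-1 corridors; nothing is claimed for
algebraically decaying couplings (Panis's reflection-positive long-range Gaussian limits have no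
Markov cells).
- Literature.Barriers.CriticalPhenomena.PositionSpaceRGNonGibbsian: inverted, not evaded — its
large-cell soft-mode hypothesis (VEFS Thm 4.9) IS the Gaussian half; BBS says the critical n.n.
block field violates it; no renormalised Hamiltonian is ever constructed.
- Literature.Barriers.CriticalPhenomena.RigorousRGSmallParameter: not engaged — no RG map, no
expansion, no small parameter.
- Literature.Barriers.CriticalPhenomena.ScaleCovarianceNotMoebius: not engaged by the new items —
covariance enters only through the shared complement ML (stmt-1344), where it bites
InversionUpgradeNormalised as recorded on that item.
- Literature.Barriers.CriticalPhenomena.BootstrapLatticeBlindness: not engaged — no CFT-data input;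
BBS is a lattice finite-volume statem

History (route lifecycle, newest last):
- 2026-08-24T22:51:52Z · DORMANT — reconciler: no traction for 7.1 d (last activity item-evidence-added at 2026-08-17T18:53:45Z); parked, not closed — `ledger route dormant route-CriticalPhenomen (operator:999:2069117)
- 2026-08-27T19:34:00Z · REACTIVATED — reconciler: reactivated — activity statement-checked at 2026-08-27T17:30:33Z after parking at 2026-08-24T22:51:52Z (operator:999:3739931)

sub-problem: Ising3DConformalLimit · status: open · opened planner-plan-novel-CriticalPhenomena-Ising3DCon-3ad144fc-v2-g19-0 2026-08-17T12:33:44Z · rev 0 · ledger route-CriticalPhenomena-PersistenceSpeed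
GENERATED by the gate from the ledger (D-0016/17). Provers cite these decls: `theorem foo : Summit.CriticalPhenomena.Ising3DConformalLimit.Theses.PersistenceSpeed.<Decl> := …` in Summits/CriticalPhenomena/Ising3DConformalLimit/Theorems/<Name>.lean.
-/

namespace Summit.CriticalPhenomena.Ising3DConformalLimit.Theses.PersistenceSpeed

open scoped BigOperators Topology Manifold Classical MeasureTheory ProbabilityTheory Matrix InnerProductSpace ComplexConjugate ContinuousMap
open Filter Set Function TopologicalSpace MeasureTheory

attribute [summit_statement] _root_.Ising3DConformalLimit

/-- item stmt-CriticalPhenomena-18094 · crux · rank 2 · open · by planner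
why it might fail: It is boundary SCREENING at the hyperscaling rate (one-arm exponent = Δσ up to the averaging): no bound m⁺_R ≤ R^{-c} is known in any d ≥ 3 (arXiv:2406.15243 §1.4.1, HandaHeydenreichSakai2019); FALSE for d ≥ 5 (m⁺_R ≳ R^{-1} ≫ R^{-3/2}); a log excess of the + profile on ℤ³ breaks it.
sources: Tasaki1987, HandaHeydenreichSakai2019, arXiv:2406.15243, DuminilcopinManolescu2022, AizenmanDuminilCopinSidoravicius2015, FriedliVelenik2017
[crux] BOUNDED BOUNDARY SIGNAL: ∃ K ≥ 2, A such that for all L ≥ 1, Σ_{x∈Λ_L}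
⟨σ_x⟩⁺_{Λ_{KL};β_c(3),0} ≤ A·(Σ_{x,y∈Λ_L} ⟨σ₀σ_{x−y}⟩⁺_{β_c})^{1/2} — the expected inner block spin
under the + boundary condition at aspect ratio K is at most A bulk standard deviations
(E⁺_{Λ_{KL}}[S_{Λ_L}] ≤ A·sd_L). Implied by one-arm hyperscaling (stmt-15591) through GKS volume
antitonicity and the Messager–Miracle-Solé box comparison (birth skeleton `Lines/birth.lean`,
composition proved). [difficulty: open-problem] -/
@[route_item "route-CriticalPhenomena-PersistenceSpeed", crux]
def BoundedBoundarySignal : Prop :=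
  ∃ K : ℕ, 2 ≤ K ∧ ∃ A : ℝ, ∀ L : ℕ, 1 ≤ L → (∑ x ∈ Literature.Probability.LatticeModels.box 3 L, Literature.Probability.LatticeModels.isingCorr (Literature.Probability.LatticeModels.zdGraph 3) (Literature.Probability.LatticeModels.box 3 (K * L)) (Literature.Probability.LatticeModels.criticalBeta 3) 0 Literature.Probability.LatticeModels.BoundaryCondition.plus ({x} : Finset (Literature.Probability.LatticeModels.Site 3))) ≤ A * Real.sqrt (∑ x ∈ Literature.Probability.LatticeModels.box 3 L, ∑ y ∈ Literature.Probability.LatticeModels.box 3 L, Literature.Probability.LatticeModels.criticalTwoPoint 3 (x - y))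

/-- item stmt-CriticalPhenomena-18095 · crux · rank 3 · open · by planner
why it might fail: Only via the Gaussian-identification step: U₄ ≡ 0 off the diagonal must force the JOINT block law Gaussian (Potter uniformity near diagonals from scale covariance + Lee–Yang/orthant analyticity); a non-Gaussian block law with vanishing off-diagonal U₄ would break capacity order.
sources: Newman1975, Lebowitz1974, GriffithsHurstSherman1970, VanenterFernandezSokal1993, doi:10.1007/bf01042596, CamiaGarbanNewman2016
[crux] TRANSFER (the lever): BoundedBoundarySignal → every pointwise scaling limit S of criticalCorr
3 (ρ > 0 on (0,1]) that is non-degenerate, translation invariant and scale covariant with some Δ has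
U₄ ≢ 0. Proof plan (registered birth skeleton, 3 stubs): threshold non-dictation P⁺_{Λ_{KL}}[S_{Λ_L}
≤ (A+2)·sd_L] ≥ 1/2 (GHS); volume-order persistence ≤ 2^{−M³} (DLR–Markov + FKG); Gaussian
capacity-order persistence ≥ exp(−C M²√M) if U₄ ≡ 0 (Potter + pairing bound + Newman Lee–Yang CLT +
Slepian + Cameron–Martin, Δ ≤ 1); the composition is kernel-checked. [deps: BoundedBoundarySignal]
[difficulty: L] -/
@[route_item "route-CriticalPhenomena-PersistenceSpeed", crux]
def U4OfBoundarySignal : Prop :=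
  BoundedBoundarySignal → ∀ (ρ : ℝ → ℝ) (Δ : ℝ) (S : Literature.Probability.LatticeModels.CorrFamily 3), (∀ δ ∈ Set.Ioc (0:ℝ) 1, 0 < ρ δ) → Literature.Probability.LatticeModels.HasPointwiseScalingLimit (Literature.Probability.LatticeModels.criticalCorr 3) ρ S → Literature.Probability.LatticeModels.IsNondegenerateTwoPoint S → Literature.Probability.LatticeModels.IsTranslationInvariant S → Literature.Probability.LatticeModels.IsScaleCovariant Δ S → Literature.Probability.LatticeModels.HasNontrivialU4 S

/-- item stmt-CriticalPhenomena-1344 · crux · rank 4 · open · by planner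
why it might fail: Existence of the full limit, O(3) invariance of the two-point kernel and inversion covariance are each open on ℤ³ (ICM2022 §8.4); scale ⇏ conformal in general (ScaleCovarianceNotMoebius) and the Ising exclusion of a Δ=2 virial current is non-rigorous.
sources: DuminilCopinICM2022, PolandRychkovVichi2019, ElshowkNakayamaRychkov2011, Literature.Barriers.CriticalPhenomena.ScaleCovarianceNotMoebius
[crux] r5 = MoebLim (IMPORTED COMPLEMENT, lowest rank): the critical Ising correlators on ℤ³ have a
non-degenerate pointwise scaling limit (ρ > 0 on (0,1], Δ > 0, S) that is Möbius covariant with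
dimension Δ — the conjunct Ising3DConformalLimit minus clause (iii). Written verbatim as the
conjunct's definiens without '∧ HasNontrivialU4 S' so that other routes filing the same complement
attach here. This route does not attack existence, rotation or inversion covariance; it bets on the
covariance lines (IsingEuclidUpgrade r5/r6 = items 0637/0638, IsingCFTData r2 = 0665, cards
hyperoctahedral-rp-rigidity / inversion-first-moebius-from-translations). S may be taken 0 off
NonCoincident, so no coincident-configuration junk obstructs the existential. -/
@[route_item "route-CriticalPhenomena-PersistenceSpeed", crux]
def MoebiusLimit : Prop :=
  ∃ (ρ : ℝ → ℝ) (Δ : ℝ) (S : Literature.Probability.LatticeModels.CorrFamily 3), (∀ δ ∈ Set.Ioc (0:ℝ) 1, 0 < ρ δ) ∧ 0 < Δ ∧ Literature.Probability.LatticeModels.HasPointwiseScalingLimit (Literature.Probability.LatticeModels.criticalCorr 3) ρ S ∧ Literature.Probability.LatticeModels.IsNondegenerateTwoPoint S ∧ Literature.Probability.LatticeModels.IsMoebiusCovariant Δ S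

/-- item stmt-CriticalPhenomena-18096 · assembly · rank 1 · open · by planner
sources: DuminilCopinICM2022, Newman1975
[assembly] BoundedBoundarySignal → U4OfBoundarySignal → MoebiusLimit → Ising3DConformalLimit (pure
logic over the covariance predicates). -/
@[route_item "route-CriticalPhenomena-PersistenceSpeed", crux]
def Assembly : Prop :=
  BoundedBoundarySignal → U4OfBoundarySignal → MoebiusLimit → Ising3DConformalLimit

/-! D-0027 §2.1 — DECIDING THEOREM (planner-authored via `route open/edit --closes-file`; by planner-plan-novel-CriticalPhenomena-Ising3DCon-3ad144fc-v2- 2026-08-17T12:33:44Z):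
its hypotheses are this route's items and its conclusion the sub-problem Statement (glue_lint), and it elaborates with this file. -/

@[closes "route-CriticalPhenomena-PersistenceSpeed"] theorem closes (hA : Assembly) (hBBS : BoundedBoundarySignal) (hU4 : U4OfBoundarySignal)
    (hML : MoebiusLimit) : Ising3DConformalLimit :=
  hA hBBS hU4 hML

end Summit.CriticalPhenomena.Ising3DConformalLimit.Theses.PersistenceSpeed
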